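import Literature.NumberTheory.GaloisRepresentations.GlobalReciprocityArtinThetaModPowers
import Literature.NumberTheory.GaloisRepresentations.ContinuousCharactersAbelianization
import Literature.AnabelianGeometry.AbsoluteAnabelian.LocalResidueMapQmodZ
import HarnessLib

/-!
# `x̄ ∈ C_Fᵐ ⟺ χ(ψ_{L|F} x) = 0` for every `ℤ/m`-character `χ` of every finite abelian layer `L ⊆ F̄`
# (Tate, C–F VII §5.1 (B)/(D), §5.4; Neukirch III (7.8), (7.12)) — the injectivity of Milne's `α¹(Γ_F, ℤ/m)` at the layers

Topic `NumberTheory/GaloisRepresentations`; namespace `Literature.NumberTheory.GaloisRepresentations`.  Theorems only (no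
definition, no named fact, no instance, no notation, no `sorry`); number fields in `Type`.

door-c6 g11/g13 recorded the injectivity of Milne's `α¹(Γ_F, ℤ/m)` for the idèle class formation at the level of the
profinite group `Γ_F^{ab}`: `mem_range_pow_iff_forall_character_artinTheta` — `x̄ ∈ C_Fᵐ` iff every CONTINUOUS
`ℚ/ℤ`-character of `Γ_F^{ab}` killed on `m`-th powers kills `θ x̄`.  Route A reads `H¹(Γ_F, ℤ/m)` as the colimit of the
layers `Hom(Gal(L/F), ℤ/m)` (door-c4's (d)); this file restates the criterion in that currency:

* §1 `exists_zmodToQmodZ_eq_of_nsmul_eq_zero`: the `m`-torsion of `ℚ/ℤ` is the image of `ℤ/m ↪ ℚ/ℤ` (`zmodToQmodZ`).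
* §2 **`artinIdeleMap_pow_of_mk_eq_pow`** / **`character_artinIdeleMap_eq_zero_of_mem_range_pow`**: if `x̄ = c^m` in
  `C_F` then `χ(ψ_{L|F} x) = 0` for every finite abelian `L ⊆ F̄` and every `χ : Gal(L/F) → ℤ/m`.
* §3 **`exists_layer_character_ne_zero_of_not_mem_range_pow`**: if `x̄ ∉ C_Fᵐ` there is a finite abelian `L ⊆ F̄` and a
  `χ : Gal(L/F) → ℤ/m` with `χ(ψ_{L|F} x) ≠ 0` — the continuous character of door-c6 g11 descends to a layer through
  the existence theorem in kernel form (`exists_ker_artinMapFamily_le`, door-c6 g13).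
* **`mem_range_pow_iff_forall_layer_character`**: `x̄ ∈ C_Fᵐ ↔ ∀ L ∀ χ, χ(ψ_{L|F} x) = 0`.

With door-c6 g14's `classInvAll_baseCup_bockstein_eq_artinIdeleMap` (`inv_{L/F}(ι[x] ∪ β_m[χ]) = −χ(ψ_{L|F} x)/m`) this is:
«`ι[x̄]` pairs to zero with every Bockstein class of every layer iff `x̄ ∈ C_Fᵐ`», i.e. the injectivity of
`α¹(Γ_F, ℤ/m) : C_F/m → H¹(Γ_F, ℤ/m)^*` (Milne I Thm. 1.8 (b)) read on the layers.

HONEST FRAMING: classical global class field theory (existence theorem + kernel of the reciprocity map) in the tree's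
currency; no case of BSD / Poitou–Tate.  Written for Route A (A5) of crux `AnticycControlAdditiveK` (cell bsd-schneider).

## References
* J. W. S. Cassels, A. Fröhlich (eds.), *Algebraic Number Theory* (1967), Ch. VII (J. Tate) §5.1 Main Theorem (B), (D),
  §5.4–5.6. [CasselsFrohlichANT1967]
* J. Neukirch, *Class Field Theory — The Bonn Lectures* (2013), Part III Thm. (7.8), (7.12). [Neukirch2013]
* J. S. Milne, *Arithmetic Duality Theorems*, 2nd ed. (2006), Ch. I Thm. 1.8 (b). [MilneADT2006]
* J.-P. Serre, *Local Fields*, GTM 67 (1979), XIII §1 (characters of profinite abelian groups). [SerreLocalFields1979]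
-/

noncomputable section

open scoped NumberField
open NumberField Field Function

namespace Literature.NumberTheory.GaloisRepresentations

open _root_.TopRep _root_.ContRepresentation _root_.ContinuousCohomology
open Literature.AnabelianGeometry.AbsoluteAnabelian.Prop121vii

/-! ## §1. The `m`-torsion of `ℚ/ℤ` is `(1/m)ℤ/ℤ` -/

/-- `zmodToQmodZ m k = k/m mod ℤ` for `k : ℤ`. [cite: SerreLocalFields1979, XIV §1] -/
theorem zmodToQmodZ_intCast (m : ℕ) [NeZero m] (k : ℤ) :
    zmodToQmodZ m (k : ZMod m) = (((k : ℚ) / m : ℚ) : AddCircle (1 : ℚ)) := by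
  rw [zmodToQmodZ, ZMod.lift_coe]
  rfl

/-- **An element of `ℚ/ℤ` killed by `m` lies in `(1/m)ℤ/ℤ`**, the image of `ℤ/m ↪ ℚ/ℤ`.
[cite: SerreLocalFields1979, XIV §1] -/
theorem exists_zmodToQmodZ_eq_of_nsmul_eq_zero (m : ℕ) [NeZero m] {q : AddCircle (1 : ℚ)} (hq : m • q = 0) :
    ∃ k : ZMod m, zmodToQmodZ m k = q := by
  induction q using QuotientAddGroup.induction_on with
  | H r =>
    have h' : ((m • r : ℚ) : AddCircle (1 : ℚ)) = 0 := by rw [AddCircle.coe_nsmul]; exact hq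
    obtain ⟨n, hn⟩ := (AddCircle.coe_eq_zero_iff (1 : ℚ)).1 h'
    rw [zsmul_eq_mul, mul_one, nsmul_eq_mul] at hn
    refine ⟨(n : ZMod m), ?_⟩
    rw [zmodToQmodZ_intCast]
    have hm : (m : ℚ) ≠ 0 := Nat.cast_ne_zero.2 (NeZero.ne m)
    rw [show ((n : ℚ) / m : ℚ) = r by rw [hn]; field_simp]

/-! ## §2. `m`-th power classes pair to zero with every layer character -/

section Layers

variable {F : Type} [Field F] [NumberField F]

/-- **If `x̄ = cᵐ` in `C_F` then `ψ_{L|F}(x) = ψ̄_{L|F}(c)ᵐ`** (the Artin map kills `Fˣ`). [cite: CasselsFrohlichANT1967, Ch. VII §4.2 Corollary (ii), §5.1] -/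
theorem artinIdeleMap_eq_pow_of_mk_eq_pow (L : IntermediateField F (AlgebraicClosure F)) [FiniteDimensional F L]
    [NumberField L] [IsAbelianGalois F L] (hR : artinReciprocity_character) {m : ℕ} {x : ideleGroup F}
    {c : ideleGroup F ⧸ principalIdeles F} (hc : c ^ m = QuotientGroup.mk x) :
    artinIdeleMap L hR x = artinClassMap L hR c ^ m := by
  rw [← artinClassMap_mk L hR x, ← hc, map_pow]

/-- **`χ(ψ_{L|F} x) = 0` for every `ℤ/m`-character of every finite abelian layer if `x̄ ∈ C_Fᵐ`.**
[cite: CasselsFrohlichANT1967, Ch. VII §5.1 Main Theorem (B)][cite: MilneADT2006, Ch. I Thm. 1.8 (b)] -/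
theorem character_artinIdeleMap_eq_zero_of_mem_range_pow (L : IntermediateField F (AlgebraicClosure F))
    [FiniteDimensional F L] [NumberField L] [IsAbelianGalois F L] (hR : artinReciprocity_character) {m : ℕ}
    {x : ideleGroup F} (hx : (QuotientGroup.mk x : ideleGroup F ⧸ principalIdeles F) ∈
      (@powMonoidHom (ideleGroup F ⧸ principalIdeles F) _ m).range)
    (χ : Additive (L ≃ₐ[F] L) →+ ZMod m) : χ (Additive.ofMul (artinIdeleMap L hR x)) = 0 := by
  obtain ⟨c, hc⟩ := hx
  rw [powMonoidHom_apply] at hc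
  rw [artinIdeleMap_eq_pow_of_mk_eq_pow L hR hc, ofMul_pow, map_nsmul, nsmul_eq_mul, ZMod.natCast_self, zero_mul]

/-! ## §3. A class outside `C_Fᵐ` is detected by a layer character -/

/-- **If `x̄ ∉ C_Fᵐ` (`m ≥ 1`), some `ℤ/m`-character of some finite abelian layer `L ⊆ F̄` does not vanish on `ψ_{L|F}(x)`.**
The continuous character `χ̃` of `Γ_F^{ab}` killed on `(Γ_F^{ab})ᵐ` with `χ̃(θ x̄) ≠ 0` (door-c6 g11,
`exists_character_apply_ne_zero_of_not_mem_range_pow` for THE reciprocity map `θ`) has `ker(χ̃ ∘ θ)` open of finite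
index in `C_F`; by the existence theorem in kernel form (`exists_ker_artinMapFamily_le`) it contains `ker ψ̄_{L|F}` for a
finite abelian `L`, so `χ̃ ∘ θ` descends to `Gal(L/F)`, with values in `(1/m)ℤ/ℤ ≅ ℤ/m`.
[cite: CasselsFrohlichANT1967, Ch. VII §5.1 Main Theorem (B), (D), §5.4][cite: Neukirch2013, Part III Thm. (7.8), (7.12)] -/
theorem exists_layer_character_ne_zero_of_not_mem_range_pow {m : ℕ} (hm : 0 < m) {x : ideleGroup F}
    (hx : (QuotientGroup.mk x : ideleGroup F ⧸ principalIdeles F) ∉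
      (@powMonoidHom (ideleGroup F ⧸ principalIdeles F) _ m).range) :
    ∃ (L : IntermediateField F (AlgebraicClosure F)) (_ : FiniteDimensional F L) (_ : IsAbelianGalois F L)
      (χ : Additive (L ≃ₐ[F] L) →+ ZMod m),
      haveI : NumberField L := NumberField.of_module_finite F L
      χ (Additive.ofMul (artinIdeleMap L artinReciprocity_character_holds x)) ≠ 0 := by
  classical
  haveI : NeZero m := ⟨hm.ne'⟩
  set θ := (isCompatibleSystem_artinMapFamily (K := F) artinReciprocity_character_holds).theta with hθdef
  have hθ : IsGlobalReciprocityMap F θ := isGlobalReciprocityMap_artinTheta F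
  obtain ⟨χ₀, hχ₀m, hχ₀x⟩ := hθ.exists_character_apply_ne_zero_of_not_mem_range_pow hm hx
  -- `f = χ₀ ∘ θ : C_F → ℚ/ℤ` as a monoid homomorphism into `Multiplicative`
  let f : (ideleGroup F ⧸ principalIdeles F) →* Multiplicative QModZCoeff.{0} :=
    (contOneCocycles.toMonoidHomOfTrivial χ₀).comp θ
  have hf : ∀ c, f c = Multiplicative.ofAdd (χ₀.1 (θ c)) := fun c => rfl
  -- its kernel is open …
  have hcont : Continuous f :=
    (continuous_ofAdd.comp χ₀.1.continuous).comp hθ.continuous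
  have hopen : IsOpen (f.ker : Set (ideleGroup F ⧸ principalIdeles F)) := by
    have : (f.ker : Set (ideleGroup F ⧸ principalIdeles F)) = f ⁻¹' {1} := by
      ext c; simp [MonoidHom.mem_ker]
    rw [this]
    exact (isOpen_discrete ({1} : Set (Multiplicative QModZCoeff.{0}))).preimage hcont
  -- … and of finite index: the values of `f` are `m`-torsion, a finite set
  have hval : ∀ c, ∃ k : ZMod m, zmodToQmodZ m k = (χ₀.1 (θ c)).down := fun c => by
    refine exists_zmodToQmodZ_eq_of_nsmul_eq_zero m ?_
    have h1 : m • χ₀.1 (θ c) = 0 := by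
      have h2 := congrArg Multiplicative.toAdd (map_pow (contOneCocycles.toMonoidHomOfTrivial χ₀) (θ c) m)
      rw [contOneCocycles.toMonoidHomOfTrivial_apply, contOneCocycles.toMonoidHomOfTrivial_apply, toAdd_ofAdd,
        toAdd_pow, toAdd_ofAdd, hχ₀m (θ c)] at h2
      exact h2.symm
    exact congrArg ULift.down h1
  have hfin : (Set.range f).Finite := by
    refine (Set.finite_range fun k : ZMod m =>
      Multiplicative.ofAdd (ULift.up.{0} (zmodToQmodZ m k) : QModZCoeff.{0})).subset ?_
    rintro _ ⟨c, rfl⟩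
    obtain ⟨k, hk⟩ := hval c
    refine ⟨k, ?_⟩
    show Multiplicative.ofAdd (ULift.up.{0} (zmodToQmodZ m k) : QModZCoeff.{0}) = f c
    rw [hk, ULift.up_down, hf c]
    rfl
  haveI : Finite f.range := hfin.to_subtype
  haveI : Finite ((ideleGroup F ⧸ principalIdeles F) ⧸ f.ker) :=
    Finite.of_equiv f.range (QuotientGroup.quotientKerEquivRange f).symm.toEquiv
  have hfi : f.ker.FiniteIndex := Subgroup.finiteIndex_of_finite_quotient
  -- existence theorem, kernel form: `ker ψ̄_L ≤ ker f` for a finite abelian `L`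
  obtain ⟨L, hLfd, hLab, hker⟩ := exists_ker_artinMapFamily_le f.ker hopen hfi
  haveI := hLfd
  haveI := hLab
  haveI : NumberField L := NumberField.of_module_finite F L
  -- descend `f` to `Gal(L/F)`
  have hsurj : Surjective (artinMapFamily F artinReciprocity_character_holds L) :=
    artinMapFamily_surjective artinReciprocity_character_holds L
  let g : (L ≃ₐ[F] L) →* Multiplicative QModZCoeff.{0} :=
    (artinMapFamily F artinReciprocity_character_holds L).liftOfSurjective hsurj ⟨f, hker⟩
  have hg : ∀ c, g (artinMapFamily F artinReciprocity_character_holds L c) = f c := fun c =>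
    (artinMapFamily F artinReciprocity_character_holds L).liftOfRightInverse_comp_apply _ _ ⟨f, hker⟩ c
  -- the values of `g` in `ℤ/m`
  have hgval : ∀ σ : L ≃ₐ[F] L, ∃ k : ZMod m, zmodToQmodZ m k = (Multiplicative.toAdd (g σ)).down := fun σ => by
    obtain ⟨c, rfl⟩ := hsurj σ
    rw [hg, hf]
    exact hval c
  choose k hk using hgval
  have hkadd : ∀ σ τ, k (σ * τ) = k σ + k τ := fun σ τ => by
    apply zmodToQmodZ_injective m
    rw [map_add, hk, hk, hk, map_mul, toAdd_mul]
    rfl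
  let χ : Additive (L ≃ₐ[F] L) →+ ZMod m :=
    AddMonoidHom.mk' (fun a => k (Additive.toMul a)) fun a b => hkadd (Additive.toMul a) (Additive.toMul b)
  refine ⟨L, hLfd, hLab, χ, fun h0 => hχ₀x ?_⟩
  -- `χ(ψ_L x) = 0` forces `χ₀(θ x̄) = 0`
  change k (artinIdeleMap L artinReciprocity_character_holds x) = 0 at h0
  have h1 := hk (artinIdeleMap L artinReciprocity_character_holds x)
  rw [h0, map_zero, ← artinClassMap_mk L artinReciprocity_character_holds x,
    ← artinMapFamily_eq artinReciprocity_character_holds L, hg, hf, toAdd_ofAdd] at h1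
  exact ULift.ext _ _ h1.symm

/-- **`x̄ ∈ C_Fᵐ ↔ χ(ψ_{L|F} x) = 0` for every finite abelian `L ⊆ F̄` and every `χ : Gal(L/F) → ℤ/m`** (`m ≥ 1`) — the
injectivity of Milne's `α¹(Γ_F, ℤ/m)` for the idèle class formation, read on the finite layers.
[cite: Neukirch2013, Part III Thm. (7.12), (7.8)][cite: CasselsFrohlichANT1967, Ch. VII §5.1 Main Theorem (B), (D)]
[cite: MilneADT2006, Ch. I Thm. 1.8 (b)] -/
theorem mem_range_pow_iff_forall_layer_character {m : ℕ} (hm : 0 < m) (x : ideleGroup F) :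
    (QuotientGroup.mk x : ideleGroup F ⧸ principalIdeles F) ∈
        (@powMonoidHom (ideleGroup F ⧸ principalIdeles F) _ m).range ↔
      ∀ (L : IntermediateField F (AlgebraicClosure F)) (_ : FiniteDimensional F L) (_ : IsAbelianGalois F L)
        (χ : Additive (L ≃ₐ[F] L) →+ ZMod m),
        haveI : NumberField L := NumberField.of_module_finite F L
        χ (Additive.ofMul (artinIdeleMap L artinReciprocity_character_holds x)) = 0 := by
  constructor
  · intro hx L hL hab χ
    haveI := hL
    haveI := hab
    haveI : NumberField L := NumberField.of_module_finite F L
    exact character_artinIdeleMap_eq_zero_of_mem_range_pow L artinReciprocity_character_holds hx χ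
  · intro h
    by_contra hx
    obtain ⟨L, hL, hab, χ, hχ⟩ := exists_layer_character_ne_zero_of_not_mem_range_pow hm hx
    exact hχ (h L hL hab χ)

end Layers

end Literature.NumberTheory.GaloisRepresentations

end
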